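import Summits.BirchSwinnertonDyer.Rank1Residual.F1Sign2.GenusClassSwitchingAtTwo
import HarnessLib

/-!
# Cell `bsd-f1-sign2` — kernel bookkeeping for the -desc MEMO-desc §33 port (`F1Sign2/GenusClassSwitchingAtTwo.lean`)

THEOREMS ONLY (no `def`, no `sorry`, no named fact; sub-namespace `…F1Sign2.GenusClassSwitchingAtTwo` so that REF1's `bc7_*` names do not crowd the cell namespace).  Contents:
REF1's sorry-free BC7 certificates VERBATIM (docstrings added by the typer where REF1 had none) from `HOME/REF1-data/b196/lean/Probe196b.lean` 635ea9a889db3e87 l.191–245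
(§196, Sketch33 v1: BC7-7 … BC7-14 — `IndependentBitPairs` = invertible 2×2 matrix over `𝔽₂` and symmetric in the rows; the docstring devices `T = X⁴` (natDegree 4, NEVER
rootless) and `T = (X² − a)²` (rootless mod `r` iff `a` non-square, i.e. with `a = Δ_W` «`r` is an involution prime») that make DESC-33-Iσ/Jσ print-grade in EVERY `dim S^X` case
(REF1 (vi), R196d); junk edges `r = 1`, `n = 1`; the genus-class relation is reflexive/symmetric; the ramified labels `(−n₀) % 8 ∈ {3, 7}`), from `Probe196c.lean` 200850a80e81a91d
l.220–272 (§196-add1, v2 per-curve rows: BC7-15 … BC7-18 — `T₃ = X⁴ − X³ − X² + 2` has natDegree 4, is ROOTLESS mod the involution primes 5, 13 and HAS roots mod 31 (`x = 15`),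
47 (`x = 3`), 3 (`x = 2`) — the genuine `dim S^X = 1` case; label arithmetic; the `B < r`-guarded form of the per-curve Selmer row), and from `HOME/REF1-data/b198/lean/Probe198.lean`
539e6c840d3d3885 l.264–326 (§198, v3 rows L33-AMB / P48: `r ≠ p`, `r·p ∣ n`, exact ℕ-divisions, the cofactors `n/(rp)`, `n/p` are prime to `p` for squarefree `n` (so
`jacobiSym ∈ {±1}`, no `= 0` junk), the `mod 8` binder = `n ≡ 1 (mod 4)`, and the conclusion shape `((A ↔ B) ↔ (j = j'))` is reflexive / symmetric / transitive on `±1`-valued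
symbols — the law is a consistent 2-colouring and cannot be refuted by chaining).  Typer -ty g18; std axioms on the farm.  BSD is not proved by this; no item closed; PARTITION none.
-/

open scoped Classical

open WeierstrassCurve Literature.NumberTheory.EllipticCurves Polynomial

namespace Summit.BirchSwinnertonDyer.Rank1Residual.F1Sign2.GenusClassSwitchingAtTwo

/-! ## REF1 §196 BC7 lemmas for Sketch33 (sorry-free) -/

/-- BC7-7: `IndependentBitPairs a b c d` IS «the 2×2 matrix `(a b; c d)` over `𝔽₂` is invertible», i.e. `ad ≠ bc` (determinant), by propositional logic. -/
theorem bc7_independentBitPairs_det (a b c d : Prop) : IndependentBitPairs a b c d ↔ ¬ ((a ∧ d) ↔ (b ∧ c)) := by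
  unfold IndependentBitPairs
  tauto

/-- BC7-8: it is symmetric in the two rows (the law does not depend on the order of the involution factors `r₁, r₂`). -/
theorem bc7_independentBitPairs_swap (a b c d : Prop) : IndependentBitPairs a b c d ↔ IndependentBitPairs c d a b := by
  unfold IndependentBitPairs
  tauto

/-- BC7-9 (the docstring's degenerate device): `T = X⁴` has natDegree `4` and is NEVER rootless (root `0` modulo every `r`), so «`Sel₂ = 0 ⟺ T rootless`» with
`T = X⁴` says «`Sel₂ ≠ 0` for every member» — the right reading whenever `dim S^X ≠ 1` (REF1: also for `dim S^X ∈ {0, 2}`, not only `≥ 3`). -/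
theorem bc7_X4_natDegree : (X ^ 4 : ℤ[X]).natDegree = 4 := by
  simp

/-- BC7-9 (cont.): `X⁴` is never rootless (root `0` modulo every `r`). -/
theorem bc7_X4_never_rootless (r : ℕ) : ¬ QuarticRootlessMod (X ^ 4) r :=
  fun h => h 0 (by simp)

/-- BC7-10 (junk edge, unreachable): modulo `r = 1` (`ZMod 1` is the zero ring) NO quartic is rootless; the rows only use prime `r > B`. -/
theorem bc7_not_rootless_mod_one (T : ℤ[X]) : ¬ QuarticRootlessMod T 1 :=
  fun h => h 0 (Subsingleton.elim _ _)

/-- BC7-11 (degenerate member): `n = 1` (the twist by `−1`, class `−n ≡ 7 (mod 8)`) has NO involution factor, so it is outside DESC-33-Iσ/I (it is a member of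
DESC-33-P's family, correctly). -/
theorem bc7_no_involution_factor_of_one (W : WeierstrassCurve ℚ) [W.IsGloballyMinimal] (r : ℕ) : ¬ OneInvolutionRestCycles W 1 r :=
  fun h => Nat.Prime.one_lt h.1 |>.ne' (Nat.dvd_one.mp h.2.1)

/-- BC7-12: the genus-class relation is reflexive and symmetric (an equivalence on labels; a label `n₀` sharing a factor with an odd bad prime makes the class EMPTY —
`jacobiSym (−n₀) ℓ = 0 ≠ ±1` — and the `∃ T` rows vacuously true for that label, harmless). -/
theorem bc7_sameGenusClass_refl (W : WeierstrassCurve ℚ) [W.IsGloballyMinimal] (n : ℕ) : SameGenusClassAtTwo W n n :=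
  ⟨rfl, fun _ _ _ _ => rfl⟩

/-- BC7-12 (cont.): the genus-class relation is symmetric. -/
theorem bc7_sameGenusClass_symm (W : WeierstrassCurve ℚ) [W.IsGloballyMinimal] (n₀ n : ℕ) (h : SameGenusClassAtTwo W n₀ n) :
    SameGenusClassAtTwo W n n₀ :=
  ⟨h.1.symm, fun ℓ hℓ h2 hb => (h.2 ℓ hℓ h2 hb).symm⟩

/-- BC7-13: the 2-ramified label condition `(−n₀) % 8 ∈ {3, 7}` means `n₀ ≡ 5 or 1 (mod 8)`; e.g. `n₀ = 1` (twist by `−1`) and `n₀ = 5` pass, `n₀ = 7` (`−7 ≡ 1`, the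
2-UNRAMIFIED class of §32) does not. -/
theorem bc7_ramified_labels : ((-(1 : ℤ)) % 8 = 3 ∨ (-(1 : ℤ)) % 8 = 7) ∧ ((-(5 : ℤ)) % 8 = 3 ∨ (-(5 : ℤ)) % 8 = 7) ∧
    ¬ ((-(7 : ℤ)) % 8 = 3 ∨ (-(7 : ℤ)) % 8 = 7) := by
  decide

/-- BC7-14 (REF1 (vi): the third device).  `(X² − a)²` has natDegree 4, and modulo a prime `r` it is rootless iff `a` is a NON-square mod `r`; with
`a = Δ_W` this is «`Frob_r` odd in `S₃`» = «`r` is an involution prime», so `T = (X² − Δ_W)²` expresses the CONSTANT law «`Sel₂ = 0` at every one-involution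
member» (the `dim S^X = 0`, even-parity case), just as `X⁴` expresses «never». -/
theorem bc7_sqQuadratic_natDegree (a : ℤ) : ((X ^ 2 - C a) ^ 2 : ℤ[X]).natDegree = 4 := by
  have h : (X ^ 2 - C a : ℤ[X]).Monic := monic_X_pow_sub_C a (by norm_num)
  rw [h.natDegree_pow, natDegree_X_pow_sub_C]

/-- BC7-14 (cont.): `(X² − a)²` is rootless mod a prime `r` iff `a` is a non-square mod `r`. -/
theorem bc7_sqQuadratic_rootless_iff (a : ℤ) (r : ℕ) [Fact r.Prime] :
    QuarticRootlessMod ((X ^ 2 - C a) ^ 2) r ↔ ∀ x : ZMod r, x ^ 2 ≠ (a : ZMod r) := by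
  unfold QuarticRootlessMod
  simp [sub_eq_zero]

/-! ## REF1 §196-add1 BC7 lemmas (sorry-free) -/

/-- BC7-15: the pinned quartic has natDegree 4 (so the per-curve rows instantiate the `∃ T, T.natDegree = 4 ∧ …` shape of DESC-33-Iσ/I with `T = T₃`, `B = 0`). -/
theorem bc7_T3_natDegree : (X ^ 4 - X ^ 3 - X ^ 2 + 2 : ℤ[X]).natDegree = 4 := by
  compute_degree!

/-- BC7-16 (instances the data rows can be read against): `T₃` is ROOTLESS mod the involution primes `5`, `13`, `61` (class X3 single-prime members `n = 5, 13, 61`: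
ENGINE 43 rows `R43| X3 5 1 0 [5]:[2] 1 0 0 0 0 …`, `… 13 … −1 0 0 0 0 …`, `… 61 … 1 0 0 0 0 …` — `c(n)` odd and PARI `Sel₂ = 0`, as both rows predict) … -/
theorem bc7_T3_rootless_mod_5 : QuarticRootlessMod (X ^ 4 - X ^ 3 - X ^ 2 + 2) 5 := by
  unfold QuarticRootlessMod
  intro x
  fin_cases x
  all_goals (simp; decide)

/-- BC7-16 (cont.): `T₃` is rootless mod `13`. -/
theorem bc7_T3_rootless_mod_13 : QuarticRootlessMod (X ^ 4 - X ^ 3 - X ^ 2 + 2) 13 := by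
  unfold QuarticRootlessMod
  intro x
  fin_cases x
  all_goals (simp; decide)

/-- … and HAS roots mod the involution primes `31` (`x = 15`) and `47` (`x = 3`) (these `r` have `−r ≡ 1 (mod 8)`, so they occur in the ramified classes only inside composite `n`),
and mod the 3-cycle prime `3` (`x = 2`; irrelevant to the rows, which read `T₃` only at the involution factor). So `T₃` is neither «never» (`X⁴`) nor «always» (`(X²−Δ)²`):
the law is the genuine `dim S^X = 1` case of REF1 §196 (vi). -/
theorem bc7_T3_root_mod_31 : ¬ QuarticRootlessMod (X ^ 4 - X ^ 3 - X ^ 2 + 2) 31 := by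
  unfold QuarticRootlessMod
  intro h
  exact h 15 (by simp; decide)

/-- BC7-16 (cont.): `T₃` has the root `x = 3` mod `47`. -/
theorem bc7_T3_root_mod_47 : ¬ QuarticRootlessMod (X ^ 4 - X ^ 3 - X ^ 2 + 2) 47 := by
  unfold QuarticRootlessMod
  intro h
  exact h 3 (by simp; decide)

/-- BC7-16 (cont.): `T₃` has the root `x = 2` mod the 3-cycle prime `3` (never read by the rows). -/
theorem bc7_T3_root_mod_3 : ¬ QuarticRootlessMod (X ^ 4 - X ^ 3 - X ^ 2 + 2) 3 := by
  unfold QuarticRootlessMod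
  intro h
  exact h 2 (by simp; decide)

/-- BC7-17: the ramified-class label arithmetic of the per-curve rows: `n = 5, 13, 61` satisfy `(−n) % 8 = 3`; `n = 31, 47` give `(−n) % 8 = 1` (unramified class). -/
theorem bc7_446_labels : (-(5 : ℤ)) % 8 = 3 ∧ (-(13 : ℤ)) % 8 = 3 ∧ (-(61 : ℤ)) % 8 = 3 ∧ (-(31 : ℤ)) % 8 = 1 ∧ (-(47 : ℤ)) % 8 = 1 := by
  decide

/-- BC7-18: the per-curve SELMER row is literally the `W = 446a1`, `(−n₀/223) = +1` instance-shape of DESC-33-Iσ with the witnesses `T := T₃`, `B := 0` — modulo identifying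
«same genus class as n₀» with the explicit pair of conditions; here we record the trivial direction usable by -ty: from the per-curve row one gets the `B < r`-guarded form. -/
theorem bc7_Is446_guarded (h : Curve446RamifiedClassSelmerSwitch)
    (W : WeierstrassCurve ℚ) [W.IsElliptic] [W.IsGloballyMinimal]
    (h1 : W.a₁ = 1) (h2 : W.a₂ = 1) (h3 : W.a₃ = 0) (h4 : W.a₄ = -30) (h6 : W.a₆ = 52) (hW : OnOddBranchRankOneAtTwo W)
    (n r : ℕ) (hn : TwistSupportGoodOdd W n) (hcl : (-(n : ℤ)) % 8 = 3 ∨ (-(n : ℤ)) % 8 = 7) (hj : jacobiSym (-(n : ℤ)) 223 = 1)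
    (hinv : OneInvolutionRestCycles W n r) (_hB : 0 < r) :
    twistSelmerTwoCard W (-(n : ℤ)) = 1 ↔ QuarticRootlessMod (X ^ 4 - X ^ 3 - X ^ 2 + 2) r :=
  h W h1 h2 h3 h4 h6 hW n r hn hcl hj hinv

/-! ## REF1 §198 BC7 lemmas for the v3 rows L33-AMB / P48 (sorry-free) -/

/-- BC7: the involution factor and the split factor are distinct (involution = `¬ split`). -/
theorem bc7_r_ne_p {W : WeierstrassCurve ℚ} [W.IsGloballyMinimal] {n r p : ℕ}
    (h : OneInvolutionOneSplitRestCycles W n r p) : r ≠ p := by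
  rintro rfl
  obtain ⟨-, -, -, -, -, hinv, hsplit, -⟩ := h
  exact hinv.2 hsplit

/-- BC7: hence `r * p ∣ n`, so the ℕ-division `n / (r * p)` in the law is exact (no junk truncation). -/
theorem bc7_rp_dvd {W : WeierstrassCurve ℚ} [W.IsGloballyMinimal] {n r p : ℕ}
    (h : OneInvolutionOneSplitRestCycles W n r p) : r * p ∣ n := by
  have hne := bc7_r_ne_p h
  obtain ⟨hr, hp, -, hrn, hpn, -⟩ := h
  exact Nat.Coprime.mul_dvd_of_dvd_of_dvd ((Nat.coprime_primes hr hp).mpr hne) hrn hpn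

/-- BC7 (cont.): the ℕ-division `n / (r * p)` is exact. -/
theorem bc7_div_exact {W : WeierstrassCurve ℚ} [W.IsGloballyMinimal] {n r p : ℕ}
    (h : OneInvolutionOneSplitRestCycles W n r p) : n / (r * p) * (r * p) = n :=
  Nat.div_mul_cancel (bc7_rp_dvd h)

/-- BC7 (cont.): the ℕ-division `n / p` is exact. -/
theorem bc7_div_exact' {W : WeierstrassCurve ℚ} [W.IsGloballyMinimal] {n r p : ℕ}
    (h : OneInvolutionOneSplitRestCycles W n r p) : n / p * p = n :=
  Nat.div_mul_cancel h.2.2.2.2.1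

/-- BC7: the 3-cycle cofactor `m = n/(r p)` is prime to `p` when `n` is squarefree, so `jacobiSym m p ∈ {±1}` (no `= 0` junk). -/
theorem bc7_cofactor_coprime {W : WeierstrassCurve ℚ} [W.IsGloballyMinimal] {n r p : ℕ}
    (hn : TwistSupportGoodOdd W n) (h : OneInvolutionOneSplitRestCycles W n r p) : ¬ p ∣ n / (r * p) := by
  intro hd
  have hsq := hn.2.1
  have hp := h.2.1
  have hpp : p * p ∣ n := by
    have e := bc7_div_exact h
    obtain ⟨k, hk⟩ := hd
    refine ⟨k * r, ?_⟩
    rw [← e, hk]; ring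
  exact hp.ne_one (Nat.isUnit_iff.mp (hsq p hpp))

/-- BC7: same for the full cofactor `n / p` of the ν = 0 law. -/
theorem bc7_cofactor_coprime' {W : WeierstrassCurve ℚ} [W.IsGloballyMinimal] {n r p : ℕ}
    (hn : TwistSupportGoodOdd W n) (h : OneInvolutionOneSplitRestCycles W n r p) : ¬ p ∣ n / p := by
  intro hd
  have hsq := hn.2.1
  have hp := h.2.1
  have hpp : p * p ∣ n := by
    have e := bc7_div_exact' h
    obtain ⟨k, hk⟩ := hd
    refine ⟨k, ?_⟩
    rw [← e, hk]; ring
  exact hp.ne_one (Nat.isUnit_iff.mp (hsq p hpp))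

/-- BC7: the `mod 8` binder of both rows says exactly `n ≡ 1 (mod 4)` (X7: `n ≡ 1`, X3: `n ≡ 5 (mod 8)`); the two members may lie in DIFFERENT classes. -/
theorem bc7_negmod8 (n : ℕ) : ((-(n : ℤ)) % 8 = 3 ∨ (-(n : ℤ)) % 8 = 7) ↔ n % 4 = 1 := by omega

/-- BC7 (shape of the conclusion `((A ↔ B) ↔ (j = j'))`): reflexive — the instance `n = n'` is trivially true, … -/
theorem bc7_conclusion_refl (A : Prop) (j : ℤ) : ((A ↔ A) ↔ (j = j)) := by simp

/-- … symmetric, … -/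
theorem bc7_conclusion_symm {A B : Prop} {j j' : ℤ} (h : (A ↔ B) ↔ (j = j')) : ((B ↔ A) ↔ (j' = j)) := by
  rw [Iff.comm (a := B), eq_comm]; exact h

/-- … and transitive on `±1`-valued symbols: two instances sharing a member give the third, so the law is a consistent
«2-colouring by the Legendre class» and cannot be refuted by chaining. -/
theorem bc7_conclusion_trans {A B C : Prop} {x y z : ℤ} (hx : x = 1 ∨ x = -1) (hy : y = 1 ∨ y = -1) (hz : z = 1 ∨ z = -1)
    (h₁ : (A ↔ B) ↔ (x = y)) (h₂ : (B ↔ C) ↔ (y = z)) : ((A ↔ C) ↔ (x = z)) := by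
  rcases hx with rfl | rfl <;> rcases hy with rfl | rfl <;> rcases hz with rfl | rfl <;> norm_num at h₁ h₂ ⊢ <;> tauto

end Summit.BirchSwinnertonDyer.Rank1Residual.F1Sign2.GenusClassSwitchingAtTwo
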